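import Mathlib.Geometry.Manifold.Instances.Quotient
import Mathlib.Geometry.Manifold.LocalDiffeomorph
import Mathlib.Geometry.Manifold.ContMDiff.Atlas
import HarnessLib

/-!
# Quotients of manifolds by free properly discontinuous smooth actions are manifolds

Mathlib endows the orbit space `MulAction.orbitRel.Quotient G M` of a free, properly discontinuous
action by homeomorphisms of a group `G` on a charted space `M` with a charted space structure
(`MulAction.instChartedSpaceQuotient`, `Mathlib/Geometry/Manifold/Instances/Quotient.lean`: the
charts are `(local inverse of the projection) ≫ (chart of M)`), and lists as TODO: "if `G` acts
smoothly, the quotient is an `IsManifold I n`" and "the projection map is smooth". This file proves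
both, together with the fact that the projection is a `C^n` local diffeomorphism:

* `Literature.Geometry.Manifold.QuotientManifold.eventuallyEq_smul_of_section`: the key local computation — a continuous
  local section `s` of the projection `π : M → M/G` composed with `π` agrees, near any point `x`
  with `π x` in the domain of `s`, with the action `x' ↦ g • x'` of a single group element `g`
  (free + properly discontinuous: the translates of a small neighbourhood are disjoint);
* `Literature.Geometry.Manifold.QuotientManifold.isManifold`: if every `g • ·` is `C^n`, the quotient charted space is a
  `C^n` manifold (chart transitions are chart transitions of `M` composed with some `g • ·`);
* `Literature.Geometry.Manifold.QuotientManifold.contMDiff_mk`: the projection `M → M/G` is `C^n`;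
* `Literature.Geometry.Manifold.QuotientManifold.isLocalDiffeomorph_mk`: the projection is a `C^n` local diffeomorphism
  (its local inverses, the local sections, are `C^n` by the same computation).

Source: standard (e.g. J. M. Lee, *Introduction to Smooth Manifolds*, 2nd ed., Ch. 21, quotients
by free proper smooth actions of discrete Lie groups; A. Kosinski, *Differential Manifolds* (1993),
I.(1.3) for the instance `ℝℙⁿ = Sⁿ/±1`). The statements here are exactly Mathlib's TODO items for
its own charted space structure, so they are tagged folklore.

Application (sibling file `RealProjectiveSpaceProofs.lean`): the standard real projective space
`𝕊ⁿ/±1` is a closed smooth `n`-manifold whose projection is a local diffeomorphism, discharging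
the named fact `Literature.Topology.FourManifolds.exists_isRealProjectiveSpace`.
-/

open scoped Manifold ContDiff Topology
open Set Function MulAction

noncomputable section

namespace Literature.Geometry.Manifold

namespace QuotientManifold

variable {𝕜 : Type*} [NontriviallyNormedField 𝕜] {E : Type*} [NormedAddCommGroup E]
  [NormedSpace 𝕜 E] {H : Type*} [TopologicalSpace H] {I : ModelWithCorners 𝕜 E H} {n : ℕ∞ω}
  {G : Type*} [Group G] {M : Type*} [TopologicalSpace M] [MulAction G M]
  [ProperlyDiscontinuousSMul G M] [ContinuousConstSMul G M] [IsCancelSMul G M] [T2Space M]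
  [LocallyCompactSpace M]

/-- The projection `M → M/G` onto the orbit space. [folklore] -/
abbrev mk : M → orbitRel.Quotient G M := Quotient.mk (orbitRel G M)

/-- The projection is a quotient covering map (Mathlib,
`isQuotientCoveringMap_quotientMk_of_properlyDiscontinuousSMul`). [folklore] -/
theorem isQuotientCoveringMap_mk : IsQuotientCoveringMap (mk (G := G) (M := M)) G :=
  isQuotientCoveringMap_quotientMk_of_properlyDiscontinuousSMul

/-- The projection is a local homeomorphism. [folklore] -/
theorem isLocalHomeomorph_mk : IsLocalHomeomorph (mk (G := G) (M := M)) :=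
  (isQuotientCoveringMap_mk (G := G) (M := M)).isCoveringMap.isLocalHomeomorph

/-- Two points have the same image in `M/G` iff they lie in the same orbit. [folklore] -/
theorem mk_eq_mk_iff {x y : M} : mk (G := G) x = mk y ↔ ∃ g : G, g • y = x := by
  rw [(isQuotientCoveringMap_mk (G := G) (M := M)).apply_eq_iff_mem_orbit, MulAction.mem_orbit_iff]

/-- `mk (g • x) = mk x`. [folklore] -/
@[simp] theorem mk_smul (g : G) (x : M) : mk (G := G) (g • x) = mk x :=
  mk_eq_mk_iff.2 ⟨g, rfl⟩

/-- **Local sections are locally translates.** Let `s` be a partial homeomorphism `M/G → M`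
which is a section of the projection on its (open) source. If `mk x ∈ s.source` then there is a
group element `g` with `s (mk x') = g • x'` for all `x'` near `x`: indeed `s (mk x) = g • x` for
some `g` (same orbit), and if `U ∋ x` is a neighbourhood disjoint from its translates by every
`h ≠ 1` (free, properly discontinuous action), then for `x' ∈ U` near `x` with
`g⁻¹ • s (mk x') ∈ U`, writing `s (mk x') = g' • x'` we get `(g⁻¹ g') • x' ∈ U ∩ (g⁻¹ g') • U`,
whence `g' = g`. [folklore] -/
theorem eventuallyEq_smul_of_section (s : OpenPartialHomeomorph (orbitRel.Quotient G M) M)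
    (hs : ∀ y ∈ s.source, mk (s y) = y) {x : M} (hx : mk x ∈ s.source) :
    ∃ g : G, (fun x' => s (mk x')) =ᶠ[𝓝 x] fun x' => g • x' := by
  obtain ⟨g, hg⟩ : ∃ g : G, g • x = s (mk x) := mk_eq_mk_iff.1 (hs _ hx)
  refine ⟨g, ?_⟩
  obtain ⟨U, hU, hdisj⟩ := (isQuotientCoveringMap_mk (G := G) (M := M)).disjoint x
  -- the continuous map `x' ↦ g⁻¹ • s (mk x')` sends `x` to `x`
  have hcont : ContinuousAt (fun x' => g⁻¹ • s (mk x')) x := by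
    refine (continuous_const_smul g⁻¹).continuousAt.comp ?_
    exact (s.continuousAt hx).comp continuous_quotient_mk'.continuousAt
  have hx' : (fun x' => g⁻¹ • s (mk x')) x = x := by
    show g⁻¹ • s (mk x) = x
    rw [← hg, inv_smul_smul]
  have h1 : (fun x' => g⁻¹ • s (mk x')) ⁻¹' U ∈ 𝓝 x := by
    refine hcont.preimage_mem_nhds ?_
    have : g⁻¹ • s (mk x) = x := by rw [← hg, inv_smul_smul]
    rw [this]
    exact hU
  have h2 : mk ⁻¹' s.source ∈ 𝓝 x :=
    (s.open_source.preimage continuous_quotient_mk').mem_nhds hx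
  filter_upwards [hU, h1, h2] with x' hxU hxU' hxs
  obtain ⟨g', hg'⟩ : ∃ g' : G, g' • x' = s (mk x') := mk_eq_mk_iff.1 (hs _ hxs)
  have hmem : (g⁻¹ * g') • x' ∈ U := by
    rw [mul_smul, hg']
    exact hxU'
  have hone : g⁻¹ * g' = 1 := hdisj _ ⟨(g⁻¹ * g') • x', ⟨x', hxU, rfl⟩, hmem⟩
  have hgg : g' = g := by
    rw [inv_mul_eq_one] at hone
    exact hone.symm
  rw [← hg', hgg]

/-- The local inverses of the projection used by Mathlib's quotient charted space are sections
of the projection on their sources. [folklore] -/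
theorem mk_localInverseAt {p : M} {y : orbitRel.Quotient G M}
    (hy : y ∈ ((isLocalHomeomorph_mk (G := G) (M := M)).localInverseAt p).source) :
    mk ((isLocalHomeomorph_mk (G := G) (M := M)).localInverseAt p y) = y :=
  (isLocalHomeomorph_mk (G := G) (M := M)).apply_localInverseAt_of_mem hy

variable [ChartedSpace H M]

/-- The charts of Mathlib's quotient charted space: every member of the atlas of `M/G` is
`s.trans (chartAt H p)` for the local inverse `s` of the projection at some `p : M`
(`MulAction.instChartedSpaceQuotient`, `IsLocalHomeomorph.chartedSpace`). [folklore] -/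
theorem exists_eq_trans_of_mem_atlas {e : OpenPartialHomeomorph (orbitRel.Quotient G M) H}
    (he : e ∈ atlas H (orbitRel.Quotient G M)) :
    ∃ p : M, e = ((isLocalHomeomorph_mk (G := G) (M := M)).localInverseAt p).trans
      (chartAt H p) := by
  obtain ⟨q, rfl⟩ := he
  exact ⟨_, rfl⟩

omit [ProperlyDiscontinuousSMul G M] [ContinuousConstSMul G M] [IsCancelSMul G M] [T2Space M]
  [LocallyCompactSpace M] in
/-- **Reading a `C^n` translate in two charts of `M`.** If `g • ·` is `C^n`, `x ∈ c.source` and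
`g • x ∈ c'.source` for two charts `c`, `c'` of the atlas of a `C^n` manifold `M`, then
`I ∘ c' ∘ (g • ·) ∘ c.symm ∘ I.symm` is `C^n` within `range I` at `I (c x)`. [folklore] -/
theorem contDiffWithinAt_chart_smul [IsManifold I n M] {g : G}
    (hg : ContMDiff I I n (fun x : M => g • x)) {c c' : OpenPartialHomeomorph M H}
    (hc : c ∈ atlas H M) (hc' : c' ∈ atlas H M) {x : M} (hx : x ∈ c.source)
    (hgx : g • x ∈ c'.source) :
    ContDiffWithinAt 𝕜 n (c'.extend I ∘ (fun x : M => g • x) ∘ (c.extend I).symm) (range I)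
      (c.extend I x) := by
  have h0 : ContMDiffWithinAt I I n (fun x : M => g • x) univ x := (hg x).contMDiffWithinAt
  have h := (contMDiffWithinAt_iff_of_mem_maximalAtlas (IsManifold.subset_maximalAtlas hc)
    (IsManifold.subset_maximalAtlas hc') hx hgx).1 h0
  simpa only [preimage_univ, univ_inter] using h.2

/-- **The orbit space of a free properly discontinuous `C^n` action is a `C^n` manifold**
(Mathlib TODO in `Geometry/Manifold/Instances/Quotient.lean`). With Mathlib's charts
`e = s ≫ c`, `e' = s' ≫ c'` (`s`, `s'` local inverses of the projection `π`, `c`, `c'` charts of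
`M`), the transition map is `c' ∘ (s' ∘ π) ∘ c.symm`, and `s' ∘ π` is locally a translate
`g • ·` (`eventuallyEq_smul_of_section`), which is `C^n` by hypothesis; so the transition maps are
`C^n` (Lee, *Introduction to Smooth Manifolds*, Ch. 21; Kosinski I.(1.3) for `Sⁿ/±1`).
[folklore] -/
theorem isManifold [IsManifold I n M] (hsmooth : ∀ g : G, ContMDiff I I n (fun x : M => g • x)) :
    IsManifold I n (orbitRel.Quotient G M) := by
  refine isManifold_of_contDiffOn I n _ fun e e' he he' => ?_
  obtain ⟨p, rfl⟩ := exists_eq_trans_of_mem_atlas he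
  obtain ⟨p', rfl⟩ := exists_eq_trans_of_mem_atlas he'
  set hf := isLocalHomeomorph_mk (G := G) (M := M) with hf_def
  set s := hf.localInverseAt p with hs_def
  set s' := hf.localInverseAt p' with hs'_def
  set c := chartAt H p with hc_def
  set c' := chartAt H p' with hc'_def
  have hc : c ∈ atlas H M := chart_mem_atlas H p
  have hc' : c' ∈ atlas H M := chart_mem_atlas H p'
  intro z hz
  obtain ⟨hz1, hz2⟩ := hz
  have hsymm : ∀ w, s.symm w = mk w := fun w => by
    rw [hs_def]
    exact congrFun (hf.localInverseAt_symm p) w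
  -- unpack the membership of `I.symm z` in the source of the transition map
  simp only [mem_preimage, OpenPartialHomeomorph.trans_source, OpenPartialHomeomorph.symm_source,
    OpenPartialHomeomorph.trans_target, mem_inter_iff, OpenPartialHomeomorph.coe_trans_symm,
    comp_apply] at hz1
  obtain ⟨⟨hzc, hzs⟩, hzs', hzc'⟩ := hz1
  set x : M := c.symm (I.symm z) with hx_def
  rw [hsymm] at hzs' hzc'
  -- `s' ∘ mk` is a translate near `x`
  obtain ⟨g, hg⟩ := eventuallyEq_smul_of_section s' (fun y hy => mk_localInverseAt hy) hzs'
  have hgx : g • x = s' (mk x) := (hg.self_of_nhds).symm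
  -- the model expression of `g • ·` in the charts `c`, `c'` is `C^n` at `z`
  have hxc : x ∈ c.source := c.map_target hzc
  have hgxc' : g • x ∈ c'.source := by rwa [hgx]
  have key := contDiffWithinAt_chart_smul (I := I) (hsmooth g) hc hc' hxc hgxc'
  have hzx : c.extend I x = z := by
    rw [OpenPartialHomeomorph.extend_coe, comp_apply, hx_def, c.right_inv hzc,
      I.right_inv hz2]
  rw [hzx] at key
  -- and it agrees with the transition map near `z` within `range I`
  refine (key.mono_of_mem_nhdsWithin ?_).congr_of_eventuallyEq ?_ ?_
  · exact nhdsWithin_mono z inter_subset_right self_mem_nhdsWithin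
  · -- eventual equality: pull back `hg` along the continuous map `z' ↦ c.symm (I.symm z')`
    have hcont : ContinuousWithinAt (fun z' => c.symm (I.symm z'))
        (I.symm ⁻¹' ((s.trans c).symm ≫ₕ s'.trans c').source ∩ range I) z := by
      refine ((c.continuousAt_symm hzc).comp I.continuous_symm.continuousAt).continuousWithinAt
    have hmem : ∀ᶠ z' in 𝓝[I.symm ⁻¹' ((s.trans c).symm ≫ₕ s'.trans c').source ∩ range I] z,
        s' (mk (c.symm (I.symm z'))) = g • c.symm (I.symm z') := by
      have := hcont.tendsto (hx_def ▸ hg : ∀ᶠ x' in 𝓝 (c.symm (I.symm z)),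
        s' (mk x') = g • x')
      exact this
    filter_upwards [hmem] with z' hz'
    simp only [comp_apply, OpenPartialHomeomorph.coe_trans, OpenPartialHomeomorph.coe_trans_symm,
      OpenPartialHomeomorph.extend_coe, OpenPartialHomeomorph.extend_coe_symm, hsymm, hz']
  · simp only [comp_apply, OpenPartialHomeomorph.coe_trans, OpenPartialHomeomorph.coe_trans_symm,
      OpenPartialHomeomorph.extend_coe, OpenPartialHomeomorph.extend_coe_symm, hsymm]
    rw [← hx_def, ← hgx]

/-- **The projection `M → M/G` is `C^n`** (Mathlib TODO): in the chart `chartAt x` of `M` and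
the chart `s' ≫ c'` of `M/G` at `mk x` it reads `c' ∘ (s' ∘ mk) ∘ (chartAt x).symm`, and
`s' ∘ mk` is a translate near `x` (Lee, *Introduction to Smooth Manifolds*, Ch. 21).
[folklore] -/
theorem contMDiff_mk [IsManifold I n M] (hsmooth : ∀ g : G, ContMDiff I I n (fun x : M => g • x)) :
    ContMDiff I I n (mk (G := G) (M := M)) := by
  intro x
  rw [contMDiffAt_iff]
  refine ⟨continuous_quotient_mk'.continuousAt, ?_⟩
  obtain ⟨p', hp'⟩ := exists_eq_trans_of_mem_atlas (chart_mem_atlas H (mk (G := G) x))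
  set hf := isLocalHomeomorph_mk (G := G) (M := M) with hf_def
  set s' := hf.localInverseAt p' with hs'_def
  set c' := chartAt H p' with hc'_def
  set c := chartAt H x with hc_def
  have hc : c ∈ atlas H M := chart_mem_atlas H x
  have hc' : c' ∈ atlas H M := chart_mem_atlas H p'
  have hxc : x ∈ c.source := mem_chart_source H x
  have hextx : extChartAt I x = c.extend I := rfl
  have hext : extChartAt I (mk x) = (s'.trans c').extend I := by
    rw [extChartAt, hp']
  have hmem : mk x ∈ (s'.trans c').source := by
    rw [← hp']
    exact mem_chart_source H (mk x)
  rw [OpenPartialHomeomorph.trans_source, mem_inter_iff, mem_preimage] at hmem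
  obtain ⟨hxs', hxc'⟩ := hmem
  obtain ⟨g, hg⟩ := eventuallyEq_smul_of_section s' (fun y hy => mk_localInverseAt hy) hxs'
  have hgx : g • x = s' (mk x) := (hg.self_of_nhds).symm
  have hgxc' : g • x ∈ c'.source := by rwa [hgx]
  have key := contDiffWithinAt_chart_smul (I := I) (hsmooth g) hc hc' hxc hgxc'
  rw [hext, hextx]
  have hcx : I.symm (c.extend I x) = c x := by
    simp only [OpenPartialHomeomorph.extend_coe, comp_apply, I.left_inv]
  refine key.congr_of_eventuallyEq ?_ ?_
  · have hcont : ContinuousWithinAt (fun z' => c.symm (I.symm z')) (range I) (c.extend I x) := by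
      refine ((c.continuousAt_symm ?_).comp I.continuous_symm.continuousAt).continuousWithinAt
      rw [hcx]
      exact c.map_source hxc
    have hx0 : c.symm (I.symm (c.extend I x)) = x := by
      rw [hcx]
      exact c.left_inv hxc
    have hmem : ∀ᶠ z' in 𝓝[range I] (c.extend I x),
        s' (mk (c.symm (I.symm z'))) = g • c.symm (I.symm z') :=
      hcont.tendsto (hx0.symm ▸ hg : ∀ᶠ x' in 𝓝 (c.symm (I.symm (c.extend I x))),
        s' (mk x') = g • x')
    filter_upwards [hmem] with z' hz'
    simp only [comp_apply, OpenPartialHomeomorph.coe_trans, OpenPartialHomeomorph.extend_coe,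
      OpenPartialHomeomorph.extend_coe_symm]
    rw [hz']
  · simp only [comp_apply, OpenPartialHomeomorph.coe_trans, OpenPartialHomeomorph.extend_coe,
      OpenPartialHomeomorph.extend_coe_symm, I.left_inv]
    rw [c.left_inv hxc, ← hgx]

/-- **The local sections of the projection are `C^n`**: the local inverse `s` of `mk` at `p`
(Mathlib's `IsLocalHomeomorph.localInverseAt`) is `C^n` on its source, for the quotient manifold
structure: in the chart `s'' ≫ c''` of `M/G` at `y` and a chart `c₀` of `M` at `s y` it reads
`c₀ ∘ (s ∘ mk) ∘ c''.symm`, and `s ∘ mk` is a translate near `s'' y`. [folklore] -/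
theorem contMDiffOn_localInverseAt [IsManifold I n M]
    (hsmooth : ∀ g : G, ContMDiff I I n (fun x : M => g • x)) (p : M) :
    ContMDiffOn I I n ((isLocalHomeomorph_mk (G := G) (M := M)).localInverseAt p)
      ((isLocalHomeomorph_mk (G := G) (M := M)).localInverseAt p).source := by
  set hf := isLocalHomeomorph_mk (G := G) (M := M) with hf_def
  set s := hf.localInverseAt p with hs_def
  intro y hy
  rw [contMDiffWithinAt_iff]
  refine ⟨(s.continuousAt hy).continuousWithinAt, ?_⟩
  obtain ⟨p'', hp''⟩ := exists_eq_trans_of_mem_atlas (chart_mem_atlas H y)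
  set s'' := hf.localInverseAt p'' with hs''_def
  set c'' := chartAt H p'' with hc''_def
  set c₀ := chartAt H (s y) with hc₀_def
  have hc'' : c'' ∈ atlas H M := chart_mem_atlas H p''
  have hc₀ : c₀ ∈ atlas H M := chart_mem_atlas H (s y)
  have hsymm'' : ∀ w, s''.symm w = mk w := fun w => by
    rw [hs''_def]
    exact congrFun (hf.localInverseAt_symm p'') w
  have hext : extChartAt I y = (s''.trans c'').extend I := by
    rw [extChartAt, hp'']
  have hext₀ : extChartAt I (s y) = c₀.extend I := rfl
  have hmem : y ∈ (s''.trans c'').source := by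
    rw [← hp'']
    exact mem_chart_source H y
  rw [OpenPartialHomeomorph.trans_source, mem_inter_iff, mem_preimage] at hmem
  obtain ⟨hys'', hyc''⟩ := hmem
  set x₀ : M := s'' y with hx₀_def
  have hx₀ : mk x₀ = y := mk_localInverseAt hys''
  obtain ⟨g, hg⟩ := eventuallyEq_smul_of_section s (fun y hy => mk_localInverseAt hy)
    (show mk x₀ ∈ s.source by rwa [hx₀])
  have hgx : g • x₀ = s y := by
    rw [← hx₀]
    exact (hg.self_of_nhds).symm
  have hgxc₀ : g • x₀ ∈ c₀.source := by
    rw [hgx]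
    exact mem_chart_source H (s y)
  have key := contDiffWithinAt_chart_smul (I := I) (hsmooth g) hc'' hc₀ hyc'' hgxc₀
  have hpt : (s''.trans c'').extend I y = c''.extend I x₀ := by
    simp only [OpenPartialHomeomorph.extend_coe, comp_apply, OpenPartialHomeomorph.coe_trans,
      hx₀_def]
  rw [hext, hext₀, hpt]
  have hcx : I.symm (c''.extend I x₀) = c'' x₀ := by
    simp only [OpenPartialHomeomorph.extend_coe, comp_apply, I.left_inv]
  refine (key.mono_of_mem_nhdsWithin ?_).congr_of_eventuallyEq ?_ ?_
  · exact nhdsWithin_mono _ inter_subset_right self_mem_nhdsWithin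
  · have hcont : ContinuousWithinAt (fun z' => c''.symm (I.symm z'))
        (((s''.trans c'').extend I).symm ⁻¹' s.source ∩ range I) (c''.extend I x₀) := by
      refine ((c''.continuousAt_symm ?_).comp I.continuous_symm.continuousAt).continuousWithinAt
      rw [hcx]
      exact c''.map_source hyc''
    have hx0 : c''.symm (I.symm (c''.extend I x₀)) = x₀ := by
      rw [hcx]
      exact c''.left_inv hyc''
    have hmem : ∀ᶠ z' in 𝓝[((s''.trans c'').extend I).symm ⁻¹' s.source ∩ range I]
        (c''.extend I x₀), s (mk (c''.symm (I.symm z'))) = g • c''.symm (I.symm z') :=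
      hcont.tendsto (hx0.symm ▸ hg : ∀ᶠ x' in 𝓝 (c''.symm (I.symm (c''.extend I x₀))),
        s (mk x') = g • x')
    filter_upwards [hmem] with z' hz'
    simp only [comp_apply, OpenPartialHomeomorph.coe_trans_symm, OpenPartialHomeomorph.extend_coe,
      OpenPartialHomeomorph.extend_coe_symm, hsymm'']
    rw [hz']
  · simp only [comp_apply, OpenPartialHomeomorph.coe_trans_symm, OpenPartialHomeomorph.extend_coe,
      OpenPartialHomeomorph.extend_coe_symm, hsymm'', I.left_inv]
    rw [c''.left_inv hyc'', hx₀, hgx]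

/-- **The projection `M → M/G` is a `C^n` local diffeomorphism** (Mathlib TODO): near `x` it is
inverted by the local section `localInverseAt x`, and both are `C^n` (`contMDiff_mk`,
`contMDiffOn_localInverseAt`) (Lee, *Introduction to Smooth Manifolds*, Ch. 21;
Kosinski I.(1.3)). [folklore] -/
theorem isLocalDiffeomorph_mk [IsManifold I n M]
    (hsmooth : ∀ g : G, ContMDiff I I n (fun x : M => g • x)) :
    IsLocalDiffeomorph I I n (mk (G := G) (M := M)) := by
  intro x
  set hf := isLocalHomeomorph_mk (G := G) (M := M) with hf_def
  set s := hf.localInverseAt x with hs_def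
  have hsymm : ∀ w, s.symm w = mk w := fun w => by
    rw [hs_def]
    exact congrFun (hf.localInverseAt_symm x) w
  refine ⟨{ toPartialEquiv := s.symm.toPartialEquiv
            open_source := s.open_target
            open_target := s.open_source
            contMDiffOn_toFun := ?_
            contMDiffOn_invFun := ?_ }, hf.self_mem_localInverseAt_target, fun y _ => ?_⟩
  · show ContMDiffOn I I n s.symm s.target
    exact (contMDiff_mk hsmooth).contMDiffOn.congr fun y _ => hsymm y
  · show ContMDiffOn I I n s s.source
    exact contMDiffOn_localInverseAt hsmooth x
  · exact (hsymm y).symm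

end QuotientManifold

end Literature.Geometry.Manifold
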